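import Literature.Probability.RandomPlanarGeometry.HexSAWBrickWallStripFugacityWidthOneContactEntropyBinary
import HarnessLib

/-!
# The joint contact rate in relative-entropy form

Child module of `…ContactEntropyBinary` (five-term / binary-entropy form of the two-density contact entropy `s`) and of the joint
contact LDP `…JointContactLDP` (§8 Gibbs form `J̃_{y,z}(a,a') = log μ₁(y,z) − a log y − a' log z − s(a,a')`).  With `ρ = 1−2a−2a'`,
`P = 4a+2a'−1`, `Q = 2a+4a'−1` and the TYPICAL values `ρ* , P*, Q*` at the typical pair `(b, b') = (b(y,z), b(z,y))`:
* §1 ★★★ **RELATIVE-ENTROPY FORM OF THE RATE**: on the open triangle,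
  `J̃_{y,z}(a,a') = ρ log(ρ/ρ*) + (P/2) log(P/P*) + (Q/2) log(Q/Q*) − a log(a/b) − a' log(a'/b')`
  — the large-deviation cost of the density pair `(a,a')` is a signed combination of five `x log(x/x*)` terms: the three "fine" masses
  `(ρ, P/2, Q/2)` against their typical values minus the two "coarse" masses `(a,a') = (P/2 + ρ/2, Q/2 + ρ/2)` against theirs (the
  fugacities enter only through the typical pair).  Equivalently `J̃` is the Bregman divergence of `−s` based at the typical pair.
* §2 ★★ at `y = z = 1`: `J̃_{1,1}(a,a') = log μ(S₁) − s(a,a')` — the ENTROPY DEFICIT (`μ(S₁)` the plastic number) — and the free energy as the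
  maximum of energy + two binary entropies: `log μ₁(y,z) = max_T {a log y + a' log z + a·H(ρ/2a) + a'·H(ρ/2a')}` (unique maximiser `(b,b')`).

## Sources
DemboZeitouni2010 §2.2 (Cramér rate functions as relative entropies / Legendre transforms); JansevanRensburg2000 §3.2 (1st ed., OUP 2000:
the density function and the free energy).  Nothing quoted AS PRINTED; statements are this lineage's.
-/

noncomputable section

open Filter Topology Finset Literature.Probability.LatticeModels Literature.Probability.Percolation SimpleGraph

namespace Literature.Probability.RandomPlanarGeometry.SAW.HexBW

open WidthOneYZ Real

variable {y z : ℝ}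

/-! ## §1 The relative-entropy form -/

/-- The logarithm of a fugacity in terms of its typical densities: `log y = 2 log P* + log Q* − log 2b − 2 log ρ*` at `(b,b') = (b(y,z), b(z,y))`
(the inverse equation of state `y = Y(b,b')`). [cite: DemboZeitouni2010, §2.2 (lane plumbing)] -/
theorem log_fugacity_eq_typical (hy : 0 < y) (hz : 0 < z) :
    Real.log y = 2 * Real.log (4 * contactB y z + 2 * contactB z y - 1) + Real.log (2 * contactB y z + 4 * contactB z y - 1) -
      (Real.log (2 * contactB y z) + 2 * Real.log (1 - 2 * contactB y z - 2 * contactB z y)) := by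
  obtain ⟨t1, t2, t3⟩ := contactB_mem_triangle hy hz
  obtain ⟨eY, -⟩ := eosY_contactB hy hz
  set b := contactB y z with hb
  set b' := contactB z y with hb'
  have hρ : (0 : ℝ) < 1 - 2 * b - 2 * b' := by linarith
  have hP : (0 : ℝ) < 4 * b + 2 * b' - 1 := by linarith
  have hQ : (0 : ℝ) < 2 * b + 4 * b' - 1 := by linarith
  have h2b : (0 : ℝ) < 2 * b := by linarith
  have eY' : y = (4 * b + 2 * b' - 1) ^ 2 * (2 * b + 4 * b' - 1) / ((2 * b) * (1 - 2 * b - 2 * b') ^ 2) := by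
    rw [← eY]; unfold eosY; ring
  rw [eY', Real.log_div (by positivity) (by positivity), Real.log_mul (by positivity) (by positivity), Real.log_pow,
    Real.log_mul (by positivity) (by positivity), Real.log_pow]
  push_cast; ring

/-- The free energy at the typical pair: `log μ₁(y,z) = b log y + b' log z + s(b,b')`. [cite: JansevanRensburg2000, §3.2 Theorem 3.18 (1st ed., p. 51; lane statement)] -/
theorem log_stripMuY₂_eq_typical (hy : 0 < y) (hz : 0 < z) :
    Real.log (stripMuY₂ 1 y z) = contactB y z * Real.log y + contactB z y * Real.log z + contactEntropy₂ (contactB y z) (contactB z y) := by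
  obtain ⟨t1, t2, t3⟩ := contactB_mem_triangle hy hz
  obtain ⟨eY, eZ⟩ := eosY_contactB hy hz
  have h := jointRate_eq_sub_contactEntropy₂ hy hz t1 t2 t3
  rw [eY, eZ, jointRate_self hy hz] at h
  linarith

/-- ★★★ **THE JOINT RATE IN RELATIVE-ENTROPY FORM**: for `y, z > 0` and `(a,a')` in the open density triangle, with `(b,b') = (b(y,z), b(z,y))`
and `ρ = 1−2a−2a'`, `P = 4a+2a'−1`, `Q = 2a+4a'−1`, `ρ* = 1−2b−2b'`, `P* = 4b+2b'−1`, `Q* = 2b+4b'−1`: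
`J̃_{y,z}(a,a') = ρ·log(ρ/ρ*) + (P/2)·log(P/P*) + (Q/2)·log(Q/Q*) − a·log(a/b) − a'·log(a'/b')`.
[cite: DemboZeitouni2010, §2.2 (rate function as a relative entropy; lane statement for the strip); JansevanRensburg2000, §3.2 Theorems 3.18–3.19 (1st ed., pp. 51–52)] -/
theorem jointRate_eosY_eq_relEntropy (hy : 0 < y) (hz : 0 < z) {a a' : ℝ} (h1 : a + a' < 1 / 2) (h2 : 1 < 4 * a + 2 * a')
    (h3 : 1 < 2 * a + 4 * a') :
    jointRate y z (eosY a a') (eosY a' a) =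
      (1 - 2 * a - 2 * a') * Real.log ((1 - 2 * a - 2 * a') / (1 - 2 * contactB y z - 2 * contactB z y))
        + (4 * a + 2 * a' - 1) / 2 * Real.log ((4 * a + 2 * a' - 1) / (4 * contactB y z + 2 * contactB z y - 1))
        + (2 * a + 4 * a' - 1) / 2 * Real.log ((2 * a + 4 * a' - 1) / (2 * contactB y z + 4 * contactB z y - 1))
        - a * Real.log (a / contactB y z) - a' * Real.log (a' / contactB z y) := by
  obtain ⟨t1, t2, t3⟩ := contactB_mem_triangle hy hz
  have ha : 0 < a := by linarith
  have ha' : 0 < a' := by linarith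
  have hbp : 0 < contactB y z := by linarith
  have hbp' : 0 < contactB z y := by linarith
  have hρ : (0 : ℝ) < 1 - 2 * a - 2 * a' := by linarith
  have hP : (0 : ℝ) < 4 * a + 2 * a' - 1 := by linarith
  have hQ : (0 : ℝ) < 2 * a + 4 * a' - 1 := by linarith
  have hρs : (0 : ℝ) < 1 - 2 * contactB y z - 2 * contactB z y := by linarith
  have hPs : (0 : ℝ) < 4 * contactB y z + 2 * contactB z y - 1 := by linarith
  have hQs : (0 : ℝ) < 2 * contactB y z + 4 * contactB z y - 1 := by linarith
  have ly := log_fugacity_eq_typical hy hz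
  have lz := log_fugacity_eq_typical hz hy
  have e1 : (1 : ℝ) - 2 * contactB z y - 2 * contactB y z = 1 - 2 * contactB y z - 2 * contactB z y := by ring
  have e2 : (4 : ℝ) * contactB z y + 2 * contactB y z - 1 = 2 * contactB y z + 4 * contactB z y - 1 := by ring
  have e3 : (2 : ℝ) * contactB z y + 4 * contactB y z - 1 = 4 * contactB y z + 2 * contactB z y - 1 := by ring
  rw [e1, e2, e3] at lz
  rw [jointRate_eq_sub_contactEntropy₂ hy hz h1 h2 h3, log_stripMuY₂_eq_typical hy hz,
    contactEntropy₂_eq_negMulLog h1 h2 h3, contactEntropy₂_eq_negMulLog t1 t2 t3, ly, lz,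
    Real.log_div hρ.ne' hρs.ne', Real.log_div hP.ne' hPs.ne', Real.log_div hQ.ne' hQs.ne', Real.log_div ha.ne' hbp.ne',
    Real.log_div ha'.ne' hbp'.ne']
  simp only [negMulLog]
  rw [Real.log_mul two_ne_zero ha.ne', Real.log_mul two_ne_zero ha'.ne', Real.log_mul two_ne_zero hbp.ne',
    Real.log_mul two_ne_zero hbp'.ne']
  ring

/-- ★★ **THE BREGMAN FORM**: `J̃_{y,z}(a,a') = s(b,b') − s(a,a') − [(a − b) log y + (a' − b') log z]`, `(b,b')` the typical pair — the rate is
the Bregman divergence of the (strictly concave) entropy's negative, based at the typical pair, whose supergradient there is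
`(−log y, −log z)`. [cite: DemboZeitouni2010, §2.2 (Legendre duality; lane statement); JansevanRensburg2000, §3.2 Theorem 3.18 (1st ed., p. 51)] -/
theorem jointRate_eosY_eq_bregman (hy : 0 < y) (hz : 0 < z) {a a' : ℝ} (h1 : a + a' < 1 / 2) (h2 : 1 < 4 * a + 2 * a')
    (h3 : 1 < 2 * a + 4 * a') :
    jointRate y z (eosY a a') (eosY a' a) =
      contactEntropy₂ (contactB y z) (contactB z y) - contactEntropy₂ a a'
        - ((a - contactB y z) * Real.log y + (a' - contactB z y) * Real.log z) := by
  rw [jointRate_eq_sub_contactEntropy₂ hy hz h1 h2 h3, log_stripMuY₂_eq_typical hy hz]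
  ring

/-! ## §2 The uniform strip: entropy deficit; the free energy as a maximum of two binary entropies plus energy -/

/-- ★★ **ENTROPY DEFICIT**: under the uniform measure (`y = z = 1`) the rate of the density pair `(a,a')` is `log μ(S₁) − s(a,a')`,
`μ(S₁) = μ₁(1,1)` the plastic number. [cite: JansevanRensburg2000, §3.2 Theorem 3.19 (1st ed., p. 52; lane statement)] -/
theorem jointRate_one_one_eq_deficit {a a' : ℝ} (h1 : a + a' < 1 / 2) (h2 : 1 < 4 * a + 2 * a') (h3 : 1 < 2 * a + 4 * a') :
    jointRate 1 1 (eosY a a') (eosY a' a) = Real.log (stripConnectiveConstant 1) - contactEntropy₂ a a' := by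
  rw [jointRate_eq_sub_contactEntropy₂ one_pos one_pos h1 h2 h3, Real.log_one, mul_zero, mul_zero, zero_add, zero_add,
    stripMuY₂_one_one_one]

/-- ★★ **THE FREE ENERGY AS A MAXIMUM OF ENERGY PLUS TWO BINARY ENTROPIES**: for `y, z > 0`,
`log μ₁(y,z) = max {a log y + a' log z + a·H(ρ/2a) + a'·H(ρ/2a') : (a,a') ∈ T}`, `ρ = 1−2a−2a'`, attained at the typical pair and only there.
[cite: JansevanRensburg2000, §3.2 Theorem 3.18 (1st ed., p. 51: F = sup{energy + entropy}); DemboZeitouni2010, §2.2 (lane statement)] -/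
theorem isGreatest_log_stripMuY₂_binEntropy (hy : 0 < y) (hz : 0 < z) :
    IsGreatest {f : ℝ | ∃ a a' : ℝ, a + a' < 1 / 2 ∧ 1 < 4 * a + 2 * a' ∧ 1 < 2 * a + 4 * a' ∧
      f = a * Real.log y + a' * Real.log z + (a * binEntropy ((1 - 2 * a - 2 * a') / (2 * a)) +
        a' * binEntropy ((1 - 2 * a - 2 * a') / (2 * a')))} (Real.log (stripMuY₂ 1 y z)) ∧
    (∀ a a' : ℝ, a + a' < 1 / 2 → 1 < 4 * a + 2 * a' → 1 < 2 * a + 4 * a' → (a ≠ contactB y z ∨ a' ≠ contactB z y) →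
      a * Real.log y + a' * Real.log z + (a * binEntropy ((1 - 2 * a - 2 * a') / (2 * a)) +
        a' * binEntropy ((1 - 2 * a - 2 * a') / (2 * a'))) < Real.log (stripMuY₂ 1 y z)) := by
  obtain ⟨⟨hmem, hub⟩, hstrict⟩ := isGreatest_log_stripMuY₂_energy_add_entropy hy hz
  refine ⟨⟨?_, ?_⟩, ?_⟩
  · obtain ⟨a, a', h1, h2, h3, hf⟩ := hmem
    exact ⟨a, a', h1, h2, h3, by rw [← contactEntropy₂_eq_binEntropy h1 h2 h3]; exact hf⟩
  · rintro f ⟨a, a', h1, h2, h3, rfl⟩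
    rw [← contactEntropy₂_eq_binEntropy h1 h2 h3]
    exact hub ⟨a, a', h1, h2, h3, rfl⟩
  · intro a a' h1 h2 h3 hne
    rw [← contactEntropy₂_eq_binEntropy h1 h2 h3]
    exact hstrict a a' h1 h2 h3 hne

end Literature.Probability.RandomPlanarGeometry.SAW.HexBW
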